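import Mathlib
import HarnessLib

/-!
# `NoHeavyLowerTail` (crux stmt-CriticalPhenomena-4575), antithetic vdBHK programme: in an OR-antimatroid every element REQUIRES at most one atom
# (the structural lemma behind CONJECTURE D of FINDING-OBSTRUCTION-g46.md §6)

Support file (seat `prim-ineq-gen-7` gen 46; `--supports stmt-CriticalPhenomena-4575`).  No `sorry`, no definitions.

SETTING.  An OR-antimatroid (search antimatroid of a digraph rooted at its atoms; e.g. the LINE SEARCH of a graph or hypergraph with any sink set,
whose colouring poset is the object of CONJECTURE RAA) is given by a ground type `E`, a set of atoms `At ⊆ E` and an enabling relation `enab f e`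
('`f` alone enables `e`').  An ENABLING CHAIN to `e` is a list `a₀ :: l` with `a₀ ∈ At`, consecutive entries related by `enab`, and last entry `e`; a set
`F` is FEASIBLE when every element of `F` has an enabling chain inside `F`; `c` is REQUIRED by `x` (`c ∈ req(x) = ⋂{F feasible ∋ x}`) when every feasible
set containing `x` contains `c`.  CONJECTURE C* (memo §6) says an antimatroid fails antipodal Kleitman iff three atoms are pairwise JOINTLY required
(`{a,b} ⊆ req(x)`, …) in a crown pattern; the lemma below shows that in an OR-antimatroid no element requires two distinct atoms, so C* contains
CONJECTURE D ('every OR-antimatroid is AK') and in particular RAA for all graphs and hypergraphs.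
* `AntitheticOrAntimatroid.support_feasible` — the support of an enabling chain is feasible (prefixes of chains are chains).
* `AntitheticOrAntimatroid.at_most_one_required_atom` — if `x` has an enabling chain, two distinct atoms cannot both be required by `x`
  (a shortest chain to `x` contains both; the one that is not its head starts a strictly shorter chain — contradiction).
-/

namespace Summit.CriticalPhenomena.PercolationContinuityZ3.Theorems

namespace AntitheticOrAntimatroid

variable {E : Type*}

/-- The support of an enabling chain `a₀ :: l` (head an atom, consecutive entries enabled) is FEASIBLE: every entry is the last entry of the
corresponding prefix, which is again an enabling chain from `a₀` inside the support. [this work] -/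
theorem support_feasible (enab : E → E → Prop) (At : Set E) (a₀ : E) (ha₀ : a₀ ∈ At) (l : List E)
    (hch : (a₀ :: l).IsChain enab) :
    ∀ e ∈ a₀ :: l, ∃ b₀ ∈ At, ∃ l' : List E, (b₀ :: l').IsChain enab ∧ (∀ y ∈ b₀ :: l', y ∈ a₀ :: l) ∧
      (b₀ :: l').getLast (List.cons_ne_nil _ _) = e := by
  intro e he
  obtain ⟨i, hi, rfl⟩ := List.getElem_of_mem he
  refine ⟨a₀, ha₀, (l.take i), ?_, ?_, ?_⟩
  · have h1 : (a₀ :: l).take (i + 1) = a₀ :: l.take i := by simp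
    rw [← h1]
    exact hch.take (i + 1)
  · intro y hy
    rcases List.mem_cons.1 hy with rfl | hy
    · exact List.mem_cons_self
    · exact List.mem_cons_of_mem _ (List.mem_of_mem_take hy)
  · have h1 : (a₀ :: l).take (i + 1) = a₀ :: l.take i := by simp
    have hne : (a₀ :: l).take (i + 1) ≠ [] := by simp
    have h2 : ((a₀ :: l).take (i + 1)).getLast hne = (a₀ :: l)[i] := by
      rw [List.getLast_eq_getElem]
      simp only [List.length_take, List.getElem_take, List.length_cons]
      congr 1
      simp only [List.length_cons] at hi
      omega
    have h3 : (a₀ :: l.take i).getLast (List.cons_ne_nil _ _) = ((a₀ :: l).take (i + 1)).getLast hne := by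
      congr 1
    rw [h3, h2]

/-- **At most one required atom.**  In an OR-antimatroid (`At` atoms, `enab f e` = '`f` enables `e`'), if `x` has an enabling chain and two atoms
`a ≠ b` are both REQUIRED by `x` — every feasible set (every element has an enabling chain inside the set) containing `x` contains `a` and `b` — we get a
contradiction: a shortest enabling chain to `x` contains `a` and `b`, one of them is not its head, and the tail starting there is a shorter enabling
chain to `x`.  Hence `req(x)` meets the atoms in at most one element and the crown pattern of CONJECTURE C* cannot occur (CONJECTURE D ⊆ C*). [this work] -/
theorem at_most_one_required_atom (enab : E → E → Prop) (At : Set E) (x a b : E) (ha : a ∈ At) (hb : b ∈ At) (hab : a ≠ b)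
    (hx : ∃ a₀ ∈ At, ∃ l : List E, (a₀ :: l).IsChain enab ∧ (a₀ :: l).getLast (List.cons_ne_nil _ _) = x)
    (hreq : ∀ c ∈ ({a, b} : Set E), ∀ F : Set E,
      (∀ e ∈ F, ∃ b₀ ∈ At, ∃ l' : List E, (b₀ :: l').IsChain enab ∧ (∀ y ∈ b₀ :: l', y ∈ F) ∧
        (b₀ :: l').getLast (List.cons_ne_nil _ _) = e) → x ∈ F → c ∈ F) :
    False := by
  classical
  -- P n : there is an enabling chain to x whose tail has length n
  let P : ℕ → Prop := fun n => ∃ a₀ ∈ At, ∃ l : List E, l.length = n ∧ (a₀ :: l).IsChain enab ∧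
    (a₀ :: l).getLast (List.cons_ne_nil _ _) = x
  have hP : ∃ n, P n := by
    obtain ⟨a₀, ha₀, l, hch, hlast⟩ := hx
    exact ⟨l.length, a₀, ha₀, l, rfl, hch, hlast⟩
  let m := Nat.find hP
  obtain ⟨a₀, ha₀, l, hlen, hch, hlast⟩ : P m := Nat.find_spec hP
  -- the support F of the shortest chain is feasible and contains x
  set F : Set E := {y | y ∈ a₀ :: l} with hF
  have hfeas : ∀ e ∈ F, ∃ b₀ ∈ At, ∃ l' : List E, (b₀ :: l').IsChain enab ∧ (∀ y ∈ b₀ :: l', y ∈ F) ∧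
      (b₀ :: l').getLast (List.cons_ne_nil _ _) = e := by
    intro e he
    exact support_feasible enab At a₀ ha₀ l hch e he
  have hxF : x ∈ F := by
    rw [hF, Set.mem_setOf_eq, ← hlast]
    exact List.getLast_mem _
  -- pick c ∈ {a, b} different from the head a₀
  obtain ⟨c, hc, hca₀⟩ : ∃ c ∈ ({a, b} : Set E), c ≠ a₀ := by
    by_cases h : a = a₀
    · exact ⟨b, by simp, fun hb' => hab (h.trans hb'.symm)⟩
    · exact ⟨a, by simp, h⟩
  have hcAt : c ∈ At := by
    rcases hc with rfl | rfl
    · exact ha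
    · exact hb
  have hcF : c ∈ F := hreq c hc F hfeas hxF
  -- c occurs in l (not as the head) at some index j
  have hcl : c ∈ l := by
    rw [hF, Set.mem_setOf_eq, List.mem_cons] at hcF
    rcases hcF with h | h
    · exact absurd h hca₀
    · exact h
  obtain ⟨j, hj, hlj⟩ := List.getElem_of_mem hcl
  -- the suffix starting at c is a shorter chain to x
  have hPshort : P (l.length - (j + 1)) := by
    refine ⟨c, hcAt, l.drop (j + 1), by simp, ?_, ?_⟩
    · have hd : (a₀ :: l).drop (j + 1) = c :: l.drop (j + 1) := by
        rw [List.drop_succ_cons]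
        rw [← hlj]
        exact (List.cons_getElem_drop_succ).symm
      rw [← hd]
      exact hch.drop (j + 1)
    · have hd : (a₀ :: l).drop (j + 1) = c :: l.drop (j + 1) := by
        rw [List.drop_succ_cons]
        rw [← hlj]
        exact (List.cons_getElem_drop_succ).symm
      have hne : (a₀ :: l).drop (j + 1) ≠ [] := by
        rw [hd]; exact List.cons_ne_nil _ _
      have h1 : (c :: l.drop (j + 1)).getLast (List.cons_ne_nil _ _) = ((a₀ :: l).drop (j + 1)).getLast hne := by
        congr 1; exact hd.symm
      rw [h1, List.getLast_drop, hlast]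
  have hmin := Nat.find_min hP (show l.length - (j + 1) < m by omega)
  exact hmin hPshort

end AntitheticOrAntimatroid

end Summit.CriticalPhenomena.PercolationContinuityZ3.Theorems
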